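import Mathlib
import Literature.Analysis.Quadrature.MidpointTrapezoidPeanoKernel
import HarnessLib

/-!
# The generalized midpoint rule (Davis–Rabinowitz 1984, Sect. 2.6.1)

Davis–Rabinowitz, *Methods of Numerical Integration* (2nd ed., 1984), Sect. 2.6.1 "Generalized Midpoint Rule",
(2.6.1.1)–(2.6.1.4) (the text credits Jagerman and F. Stetter).

Setting of the text: a weight `w > 0` on `[a, b]` normalised by `∫_a^b w = 1`; `H(x) = ∫_a^x w(t) dt` (2.6.1.1)
increases from `H(a) = 0` to `H(b) = 1` and has an inverse `L` on `[0, 1]`.  For an integer `N ≥ 1` the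
abscissas are `x_i = N ∫_{i/N}^{(i+1)/N} L(y) dy`, `i = 0, …, N - 1` (2.6.1.2), and the generalized midpoint rule
is the EQUAL-WEIGHT rule `∫_a^b w f ≈ N⁻¹ Σ_{i<N} f(x_i)` (2.6.1.3); it is exact on `𝒫₁` and its error is
`E = ½ C_N f''(ξ)` with `C_N = ∫_a^b x² w(x) dx - N⁻¹ Σ_{i<N} x_i²` (2.6.1.4).

This file works in the variable `y = H(x)`.  By the substitution (2.6.1.1), for continuous `g`,
`∫_a^b w(x) g(x) dx = ∫_0^1 g(L(y)) dy` (`integral_comp_weightInverse_eq`; hypotheses: `w` continuous,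
`L` continuous with `L(H(x)) = x` on `[a, b]`, `∫_a^b w = 1`), so each claim about `∫_a^b w f` is a claim about
`∫_0^1 f(L(y)) dy`, which is then proved for an ARBITRARY `L` continuous on `[0, 1]`:
* (2.6.1.2)/(2.6.1.3) `genMidpointNode`, `genMidpointRule`; the text's computation
  `∫_a^b x w(x) dx = ∫_0^1 L(y) dy = N⁻¹[x_0 + ⋯ + x_{N-1}]` (`integral_eq_inv_mul_sum_genMidpointNode`) and
  exactness on `𝒫₁` (`integral_comp_eq_genMidpointRule_of_natDegree_le_one`; on the `w`-side
  `weightedIntegral_eq_genMidpointRule_of_natDegree_le_one`);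
* (2.6.1.4) `genMidpointErrConst` `= C_N` (`= ∫_0^1 L² - N⁻¹ Σ x_i²`), its variance form
  `C_N = Σ_{i<N} ∫_{i/N}^{(i+1)/N} (L(y) - x_i)² dy` (`genMidpointErrConst_eq_sum`), hence `C_N ≥ 0`
  (`genMidpointErrConst_nonneg`); the error pinned on quadratics,
  `∫_0^1 p(L(y)) dy - N⁻¹ Σ p(x_i) = C_N · c₂ = ½ C_N p''` for `deg p ≤ 2`
  (`integral_comp_sub_genMidpointRule_of_natDegree_le_two`); and the SIGN of the error for convex integrands,
  `N⁻¹ Σ f(x_i) ≤ ∫_0^1 f(L(y)) dy` (Jensen's inequality on each cell;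
  `genMidpointRule_le_integral_comp_of_convexOn`) — consistent with `E = ½ C_N f''(ξ)`, whose `ξ`-form is not
  restated here;
* the text's remark that the abscissas increase (`genMidpointNode_le_succ`, for monotone `L`);
* the classical case `w ≡ 1` on `[0, 1]`, `L = id`: `x_i = (2i+1)/(2N)` are the midpoints, the rule is the
  compound midpoint rule `M_N` on `[0, 1]` (`midpointRule` of `MidpointTrapezoidPeanoKernel`, (2.1.3);
  `genMidpointRule_id_eq_midpointRule`) and `C_N = 1/(12N²)`, i.e. `E = f''/(24N²)` (cf. (2.1.3), (2.6.5))
  (`genMidpointNode_id`, `genMidpointErrConst_id`); in this case the Jensen sign above is the midpoint half of the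
  bracketing in `ConvexBracketing` (`midpointSum_le_integral_of_convexOn`), which is not restated.

Provenance: engines group, shared numerical engines serving client cells; rigour lives in the verifiers; every
published number belongs to a client cell's ledger, not to the engines group.  Textbook facts only (no client
numbers).
-/

namespace Literature.Analysis.Quadrature

open Real Set MeasureTheory intervalIntegral Finset Polynomial
open scoped Real Interval

noncomputable section

/-! ### (2.6.1.1): the substitution `y = H(x)` -/

/-- (2.6.1.1): with `H(x) = ∫_a^x w`, `∫_a^b w = 1` and `L ∘ H = id` on `[a, b]` (so `L` inverts `H`),
`∫_0^1 g(L(y)) dy = ∫_a^b w(x) g(x) dx` for continuous `g` (substitution `y = H(x)`, `dy = w(x) dx`).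
[cite: DavisRabinowitz1984, Sect. 2.6.1 (2.6.1.1)] -/
theorem integral_comp_weightInverse_eq {w L g : ℝ → ℝ} {a b : ℝ} (hw : Continuous w) (hL : Continuous L)
    (hg : Continuous g) (hLH : ∀ x ∈ uIcc a b, L (∫ t in a..x, w t) = x) (h1 : ∫ t in a..b, w t = 1) :
    ∫ y in (0 : ℝ)..1, g (L y) = ∫ x in a..b, w x * g x := by
  have hH : ∀ x ∈ uIcc a b, HasDerivAt (fun u => ∫ t in a..u, w t) (w x) x := fun x _ =>
    (hw.integral_hasStrictDerivAt a x).hasDerivAt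
  have key := intervalIntegral.integral_comp_mul_deriv hH hw.continuousOn (hg.comp hL)
  rw [intervalIntegral.integral_same, h1] at key
  simp only [Function.comp_apply] at key
  rw [← key]
  refine intervalIntegral.integral_congr fun x hx => ?_
  simp only [hLH x hx]
  ring

/-! ### (2.6.1.2)–(2.6.1.3): abscissas and the rule -/

/-- (2.6.1.2): the abscissas `x_i = N ∫_{i/N}^{(i+1)/N} L(y) dy`, `i = 0, …, N-1`.
[cite: DavisRabinowitz1984, Sect. 2.6.1 (2.6.1.2)] -/
def genMidpointNode (L : ℝ → ℝ) (N i : ℕ) : ℝ :=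
  N * ∫ y in (i / N : ℝ)..((i + 1) / N), L y

/-- (2.6.1.3): the generalized midpoint rule `N⁻¹ Σ_{i<N} f(x_i)` (equal weights `1/N`).
[cite: DavisRabinowitz1984, Sect. 2.6.1 (2.6.1.3)] -/
def genMidpointRule (f L : ℝ → ℝ) (N : ℕ) : ℝ :=
  (N : ℝ)⁻¹ * ∑ i ∈ Finset.range N, f (genMidpointNode L N i)

/-- (2.6.1.4): the error constant `C_N = ∫_a^b x² w(x) dx - N⁻¹ Σ x_i² = ∫_0^1 L(y)² dy - N⁻¹ Σ x_i²`.
[cite: DavisRabinowitz1984, Sect. 2.6.1 (2.6.1.4)] -/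
def genMidpointErrConst (L : ℝ → ℝ) (N : ℕ) : ℝ :=
  (∫ y in (0 : ℝ)..1, L y ^ 2) - (N : ℝ)⁻¹ * ∑ i ∈ Finset.range N, genMidpointNode L N i ^ 2

/-- With one abscissa the rule is `f(x_0)`, `x_0 = ∫_0^1 L = ∫_a^b x w(x) dx` the centroid of the weight.
[cite: DavisRabinowitz1984, Sect. 2.6.1 (2.6.1.3)] -/
theorem genMidpointRule_one (f L : ℝ → ℝ) : genMidpointRule f L 1 = f (∫ y in (0 : ℝ)..1, L y) := by
  simp [genMidpointRule, genMidpointNode]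

/-- [folklore] The cells `[i/N, (i+1)/N]`, `i < N`, lie in `[0, 1]`. -/
private theorem cell_subset {N : ℕ} (hN : N ≠ 0) {i : ℕ} (hi : i < N) :
    uIcc ((i : ℝ) / N) ((i + 1) / N) ⊆ uIcc (0 : ℝ) 1 := by
  have hN' : (0 : ℝ) < N := by exact_mod_cast Nat.pos_of_ne_zero hN
  have h1 : (i : ℝ) + 1 ≤ N := by exact_mod_cast Nat.succ_le_of_lt hi
  have hle : (i : ℝ) / N ≤ (i + 1) / N := by gcongr; linarith
  rw [Set.uIcc_of_le hle, Set.uIcc_of_le zero_le_one]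
  exact Set.Icc_subset_Icc (by positivity) (by rw [div_le_one hN']; exact h1)

/-- [folklore] `[0, 1]` is the union of the cells: `Σ_{i<N} ∫_{i/N}^{(i+1)/N} F = ∫_0^1 F`. -/
private theorem sum_integral_cells (F : ℝ → ℝ) {N : ℕ} (hN : N ≠ 0)
    (hF : ∀ i < N, IntervalIntegrable F volume ((i : ℝ) / N) ((i + 1) / N)) :
    ∑ i ∈ Finset.range N, ∫ y in ((i : ℝ) / N)..((i + 1) / N), F y = ∫ y in (0 : ℝ)..1, F y := by
  have hN' : (N : ℝ) ≠ 0 := Nat.cast_ne_zero.mpr hN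
  have key := intervalIntegral.sum_integral_adjacent_intervals (μ := volume) (f := F)
    (a := fun i : ℕ => (i : ℝ) / N) (n := N) (fun k hk => by simpa only [Nat.cast_succ] using hF k hk)
  simpa only [Nat.cast_zero, zero_div, Nat.cast_succ, div_self hN'] using key

/-- The text's computation behind exactness on `𝒫₁`: `∫_a^b x w(x) dx = ∫_0^1 L(y) dy = N⁻¹[x_0 + ⋯ + x_{N-1}]`.
[cite: DavisRabinowitz1984, Sect. 2.6.1 (2.6.1.3)] -/
theorem integral_eq_inv_mul_sum_genMidpointNode (L : ℝ → ℝ) (hL : ContinuousOn L (uIcc 0 1)) {N : ℕ}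
    (hN : N ≠ 0) : ∫ y in (0 : ℝ)..1, L y = (N : ℝ)⁻¹ * ∑ i ∈ Finset.range N, genMidpointNode L N i := by
  have hN' : (N : ℝ) ≠ 0 := Nat.cast_ne_zero.mpr hN
  rw [← sum_integral_cells L hN fun i hi => (hL.mono (cell_subset hN hi)).intervalIntegrable, Finset.mul_sum]
  refine Finset.sum_congr rfl fun i _ => ?_
  rw [genMidpointNode, ← mul_assoc, inv_mul_cancel₀ hN', one_mul]

/-- (2.6.1.3): the generalized midpoint rule is exact on `𝒫₁`:
`∫_0^1 p(L(y)) dy = N⁻¹ Σ_{i<N} p(x_i)` for `deg p ≤ 1` ("it integrates constants exactly, and … the function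
`x` and hence all linear functions"). [cite: DavisRabinowitz1984, Sect. 2.6.1 (2.6.1.3)] -/
theorem integral_comp_eq_genMidpointRule_of_natDegree_le_one (p : ℝ[X]) (hp : p.natDegree ≤ 1) (L : ℝ → ℝ)
    (hL : ContinuousOn L (uIcc 0 1)) {N : ℕ} (hN : N ≠ 0) :
    ∫ y in (0 : ℝ)..1, p.eval (L y) = genMidpointRule (fun x => p.eval x) L N := by
  have hN' : (N : ℝ) ≠ 0 := Nat.cast_ne_zero.mpr hN
  obtain ⟨α, β, rfl⟩ := exists_eq_X_add_C_of_natDegree_le_one hp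
  have hLi : IntervalIntegrable L volume 0 1 := hL.intervalIntegrable
  simp only [eval_add, eval_mul, eval_C, eval_X, genMidpointRule]
  rw [intervalIntegral.integral_add (hLi.const_mul α) intervalIntegrable_const,
    intervalIntegral.integral_const_mul, intervalIntegral.integral_const,
    integral_eq_inv_mul_sum_genMidpointNode L hL hN, Finset.sum_add_distrib, Finset.sum_const, Finset.card_range,
    ← Finset.mul_sum]
  simp only [smul_eq_mul, sub_zero, one_mul, nsmul_eq_mul]
  rw [mul_add (N : ℝ)⁻¹, ← mul_assoc (N : ℝ)⁻¹ (N : ℝ) β, inv_mul_cancel₀ hN', one_mul]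
  ring

/-- (2.6.1.3) on the `w`-side: in the text's setting (`w`, `L`, `H` as in (2.6.1.1)),
`∫_a^b w(x) p(x) dx = N⁻¹ Σ_{i<N} p(x_i)` for every `p` of degree `≤ 1`.
[cite: DavisRabinowitz1984, Sect. 2.6.1 (2.6.1.3)] -/
theorem weightedIntegral_eq_genMidpointRule_of_natDegree_le_one {w L : ℝ → ℝ} {a b : ℝ} (hw : Continuous w)
    (hL : Continuous L) (hLH : ∀ x ∈ uIcc a b, L (∫ t in a..x, w t) = x) (h1 : ∫ t in a..b, w t = 1)
    (p : ℝ[X]) (hp : p.natDegree ≤ 1) {N : ℕ} (hN : N ≠ 0) :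
    ∫ x in a..b, w x * p.eval x = genMidpointRule (fun x => p.eval x) L N := by
  rw [← integral_comp_weightInverse_eq hw hL p.continuous hLH h1,
    integral_comp_eq_genMidpointRule_of_natDegree_le_one p hp L hL.continuousOn hN]

/-! ### (2.6.1.4): the error constant `C_N` -/

/-- [folklore] `∫_u^v (L - c)² = ∫_u^v L² - 2c ∫_u^v L + (v - u) c²`. -/
private theorem integral_sq_sub_const (L : ℝ → ℝ) {u v : ℝ} (hLi : IntervalIntegrable L volume u v)
    (hL2 : IntervalIntegrable (fun y => L y ^ 2) volume u v) (c : ℝ) :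
    ∫ y in u..v, (L y - c) ^ 2 = (∫ y in u..v, L y ^ 2) - 2 * c * (∫ y in u..v, L y) + (v - u) * c ^ 2 := by
  have h1 : ∫ y in u..v, (L y - c) ^ 2 = ∫ y in u..v, (L y ^ 2 - 2 * c * L y + c ^ 2) :=
    intervalIntegral.integral_congr fun y _ => by ring
  rw [h1, intervalIntegral.integral_add (hL2.sub (hLi.const_mul _)) intervalIntegrable_const,
    intervalIntegral.integral_sub hL2 (hLi.const_mul _), intervalIntegral.integral_const_mul,
    intervalIntegral.integral_const, smul_eq_mul]

/-- (2.6.1.4), variance form of the error constant: `C_N = Σ_{i<N} ∫_{i/N}^{(i+1)/N} (L(y) - x_i)² dy`.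
[cite: DavisRabinowitz1984, Sect. 2.6.1 (2.6.1.4)] -/
theorem genMidpointErrConst_eq_sum (L : ℝ → ℝ) (hL : ContinuousOn L (uIcc 0 1)) {N : ℕ} (hN : N ≠ 0) :
    genMidpointErrConst L N =
      ∑ i ∈ Finset.range N, ∫ y in ((i : ℝ) / N)..((i + 1) / N), (L y - genMidpointNode L N i) ^ 2 := by
  have hN' : (N : ℝ) ≠ 0 := Nat.cast_ne_zero.mpr hN
  unfold genMidpointErrConst
  rw [← sum_integral_cells (fun y => L y ^ 2) hN fun i hi => ((hL.pow 2).mono (cell_subset hN hi)).intervalIntegrable,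
    Finset.mul_sum, ← Finset.sum_sub_distrib]
  refine Finset.sum_congr rfl fun i hi => ?_
  have hi' := Finset.mem_range.mp hi
  have hLi : IntervalIntegrable L volume ((i : ℝ) / N) ((i + 1) / N) :=
    (hL.mono (cell_subset hN hi')).intervalIntegrable
  have hL2 : IntervalIntegrable (fun y => L y ^ 2) volume ((i : ℝ) / N) ((i + 1) / N) :=
    ((hL.pow 2).mono (cell_subset hN hi')).intervalIntegrable
  have hI : ∫ y in ((i : ℝ) / N)..((i + 1) / N), L y = (N : ℝ)⁻¹ * genMidpointNode L N i := by
    rw [genMidpointNode, ← mul_assoc, inv_mul_cancel₀ hN', one_mul]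
  rw [integral_sq_sub_const L hLi hL2, hI]
  field_simp
  ring

/-- (2.6.1.4): `C_N ≥ 0`. [cite: DavisRabinowitz1984, Sect. 2.6.1 (2.6.1.4)] -/
theorem genMidpointErrConst_nonneg (L : ℝ → ℝ) (hL : ContinuousOn L (uIcc 0 1)) {N : ℕ} (hN : N ≠ 0) :
    0 ≤ genMidpointErrConst L N := by
  rw [genMidpointErrConst_eq_sum L hL hN]
  refine Finset.sum_nonneg fun i _ => ?_
  have hle : (i : ℝ) / N ≤ (i + 1) / N := by
    have hN' : (0 : ℝ) < N := by exact_mod_cast Nat.pos_of_ne_zero hN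
    gcongr; linarith
  exact intervalIntegral.integral_nonneg hle fun y _ => sq_nonneg _

/-- [folklore] A polynomial of degree `≤ 2` as `c₂ x² + (c₁ x + c₀)`. -/
private theorem eval_eq_of_natDegree_le_two (p : ℝ[X]) (hp : p.natDegree ≤ 2) (x : ℝ) :
    p.eval x = p.coeff 2 * x ^ 2 + (p.coeff 1 * x + p.coeff 0) := by
  conv_lhs => rw [p.as_sum_range' 3 (by omega)]
  simp [Finset.sum_range_succ]
  ring

/-- (2.6.1.4) pinned on quadratics: for `deg p ≤ 2`,
`∫_0^1 p(L(y)) dy - N⁻¹ Σ_{i<N} p(x_i) = C_N · c₂ = ½ C_N p''` (so `E(x²) = C_N` exactly).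
[cite: DavisRabinowitz1984, Sect. 2.6.1 (2.6.1.4)] -/
theorem integral_comp_sub_genMidpointRule_of_natDegree_le_two (p : ℝ[X]) (hp : p.natDegree ≤ 2)
    (L : ℝ → ℝ) (hL : ContinuousOn L (uIcc 0 1)) {N : ℕ} (hN : N ≠ 0) :
    (∫ y in (0 : ℝ)..1, p.eval (L y)) - genMidpointRule (fun x => p.eval x) L N =
      genMidpointErrConst L N * p.coeff 2 := by
  have hN' : (N : ℝ) ≠ 0 := Nat.cast_ne_zero.mpr hN
  have hLi : IntervalIntegrable L volume 0 1 := hL.intervalIntegrable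
  have hL2 : IntervalIntegrable (fun y => L y ^ 2) volume 0 1 := (hL.pow 2).intervalIntegrable
  simp only [genMidpointRule, genMidpointErrConst, eval_eq_of_natDegree_le_two p hp]
  rw [intervalIntegral.integral_add (hL2.const_mul _) ((hLi.const_mul _).add intervalIntegrable_const),
    intervalIntegral.integral_add (hLi.const_mul _) intervalIntegrable_const,
    intervalIntegral.integral_const_mul, intervalIntegral.integral_const_mul, intervalIntegral.integral_const,
    integral_eq_inv_mul_sum_genMidpointNode L hL hN, Finset.sum_add_distrib, Finset.sum_add_distrib,
    Finset.sum_const, Finset.card_range, ← Finset.mul_sum, ← Finset.mul_sum]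
  simp only [smul_eq_mul, sub_zero, one_mul, nsmul_eq_mul]
  field_simp
  ring

/-- The second derivative of a quadratic is the constant `2 c₂`, identifying `C_N · c₂` with `½ C_N p''(ξ)`.
[cite: DavisRabinowitz1984, Sect. 2.6.1 (2.6.1.4)] -/
theorem iteratedDeriv_two_eval_of_natDegree_le_two (p : ℝ[X]) (hp : p.natDegree ≤ 2) (ξ : ℝ) :
    iteratedDeriv 2 (fun x => p.eval x) ξ = 2 * p.coeff 2 := by
  have h1 : deriv (fun x => p.eval x) = fun x => p.derivative.eval x := funext fun x => p.deriv
  rw [iteratedDeriv_succ, iteratedDeriv_one, h1, Polynomial.deriv]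
  have hd0 : p.derivative.derivative.natDegree ≤ 0 := by
    have := natDegree_derivative_le p
    have := natDegree_derivative_le p.derivative
    omega
  rw [eq_C_of_natDegree_le_zero hd0, eval_C]
  simp only [coeff_derivative, Nat.cast_zero, zero_add, Nat.cast_one]
  ring

/-! ### The sign of the error for convex integrands (Jensen on each cell) -/

/-- (2.6.1.4), sign of the error: for every convex continuous `f`, `N⁻¹ Σ_{i<N} f(x_i) ≤ ∫_0^1 f(L(y)) dy`
(Jensen's inequality on each cell, `x_i` being the mean of `L` over `[i/N, (i+1)/N]`); this is the sign
predicted by `E = ½ C_N f''(ξ)` when `f'' ≥ 0`. [cite: DavisRabinowitz1984, Sect. 2.6.1 (2.6.1.4)] -/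
theorem genMidpointRule_le_integral_comp_of_convexOn (f : ℝ → ℝ) (hf : ConvexOn ℝ univ f) (hfc : Continuous f)
    (L : ℝ → ℝ) (hL : ContinuousOn L (uIcc 0 1)) {N : ℕ} (hN : N ≠ 0) :
    genMidpointRule f L N ≤ ∫ y in (0 : ℝ)..1, f (L y) := by
  have hN' : (0 : ℝ) < N := by exact_mod_cast Nat.pos_of_ne_zero hN
  have hN'' : (N : ℝ) ≠ 0 := hN'.ne'
  rw [genMidpointRule, ← sum_integral_cells (fun y => f (L y)) hN fun i hi =>
    ((hfc.comp_continuousOn hL).mono (cell_subset hN hi)).intervalIntegrable, Finset.mul_sum]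
  refine Finset.sum_le_sum fun i hi => ?_
  have hi' := Finset.mem_range.mp hi
  have hle : (i : ℝ) / N ≤ (i + 1) / N := by gcongr; linarith
  have hLi : IntervalIntegrable L volume ((i : ℝ) / N) ((i + 1) / N) :=
    (hL.mono (cell_subset hN hi')).intervalIntegrable
  have hfLi : IntervalIntegrable (fun y => f (L y)) volume ((i : ℝ) / N) ((i + 1) / N) :=
    ((hfc.comp_continuousOn hL).mono (cell_subset hN hi')).intervalIntegrable
  have hvol : volume (Ioc ((i : ℝ) / N) ((i + 1) / N)) = ENNReal.ofReal ((N : ℝ)⁻¹) := by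
    rw [Real.volume_Ioc]
    congr 1
    field_simp
    ring
  have h0 : volume (Ioc ((i : ℝ) / N) ((i + 1) / N)) ≠ 0 := by
    rw [hvol]
    exact (ENNReal.ofReal_pos.mpr (inv_pos.mpr hN')).ne'
  have htop : volume (Ioc ((i : ℝ) / N) ((i + 1) / N)) ≠ ⊤ := by
    rw [hvol]
    exact ENNReal.ofReal_ne_top
  have J := hf.map_set_average_le hfc.continuousOn isClosed_univ h0 htop
    (Filter.Eventually.of_forall fun _ => Set.mem_univ _) hLi.1 hfLi.1
  rw [MeasureTheory.setAverage_eq, MeasureTheory.setAverage_eq, measureReal_def, hvol,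
    ENNReal.toReal_ofReal (inv_pos.mpr hN').le, inv_inv, smul_eq_mul, smul_eq_mul,
    ← intervalIntegral.integral_of_le hle, ← intervalIntegral.integral_of_le hle] at J
  rw [genMidpointNode]
  calc (N : ℝ)⁻¹ * f (N * ∫ y in ((i : ℝ) / N)..((i + 1) / N), L y)
      ≤ (N : ℝ)⁻¹ * (N * ∫ y in ((i : ℝ) / N)..((i + 1) / N), f (L y)) := by gcongr
    _ = ∫ y in ((i : ℝ) / N)..((i + 1) / N), f (L y) := by
      rw [← mul_assoc, inv_mul_cancel₀ hN'', one_mul]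

/-! ### The abscissas increase (monotone `L`) -/

/-- "The values `x_i` will be monotonically increasing": for `L` monotone on `[0, 1]`, `x_i ≤ x_{i+1}`
(`i + 1 < N`). [cite: DavisRabinowitz1984, Sect. 2.6.1 (2.6.1.2)] -/
theorem genMidpointNode_le_succ (L : ℝ → ℝ) (hL : MonotoneOn L (uIcc 0 1)) {N : ℕ} {i : ℕ} (hi : i + 1 < N) :
    genMidpointNode L N i ≤ genMidpointNode L N (i + 1) := by
  have hN : N ≠ 0 := by omega
  have hN' : (0 : ℝ) < N := by exact_mod_cast Nat.pos_of_ne_zero hN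
  have hi0 : i < N := by omega
  have hle : (i : ℝ) / N ≤ (i + 1) / N := by gcongr; linarith
  have hle' : ((i : ℝ) + 1) / N ≤ (i + 1 + 1) / N := by gcongr; linarith
  have hsub := cell_subset hN hi0
  have hsub' : uIcc (((i : ℝ) + 1) / N) ((i + 1 + 1) / N) ⊆ uIcc (0 : ℝ) 1 := by
    have := cell_subset hN hi
    push_cast at this
    exact this
  have hm : (i + 1 : ℝ) / N ∈ uIcc (0 : ℝ) 1 := hsub (by rw [Set.uIcc_of_le hle]; exact Set.right_mem_Icc.mpr hle)
  -- `x_i ≤ L((i+1)/N) ≤ x_{i+1}`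
  have hup : ∫ y in ((i : ℝ) / N)..((i + 1) / N), L y ≤ ∫ _ in ((i : ℝ) / N)..((i + 1) / N), L ((i + 1) / N) := by
    refine intervalIntegral.integral_mono_on hle (hL.mono hsub).intervalIntegrable intervalIntegrable_const
      fun y hy => hL (hsub ?_) hm hy.2
    rw [Set.uIcc_of_le hle]; exact hy
  have hdown : ∫ _ in (((i : ℝ) + 1) / N)..((i + 1 + 1) / N), L ((i + 1) / N) ≤
      ∫ y in (((i : ℝ) + 1) / N)..((i + 1 + 1) / N), L y := by
    refine intervalIntegral.integral_mono_on hle' intervalIntegrable_const (hL.mono hsub').intervalIntegrable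
      fun y hy => hL hm (hsub' ?_) hy.1
    rw [Set.uIcc_of_le hle']; exact hy
  rw [intervalIntegral.integral_const, smul_eq_mul] at hup hdown
  unfold genMidpointNode
  push_cast
  have e1 : ((i : ℝ) + 1) / N - i / N = (N : ℝ)⁻¹ := by field_simp; ring
  have e2 : ((i : ℝ) + 1 + 1) / N - (i + 1) / N = (N : ℝ)⁻¹ := by field_simp; ring
  rw [e1] at hup
  rw [e2] at hdown
  calc (N : ℝ) * ∫ y in ((i : ℝ) / N)..((i + 1) / N), L y ≤ N * ((N : ℝ)⁻¹ * L ((i + 1) / N)) := by gcongr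
    _ ≤ N * ∫ y in (((i : ℝ) + 1) / N)..((i + 1 + 1) / N), L y := by gcongr

/-! ### The classical midpoint rule: `w ≡ 1` on `[0, 1]`, `L = id` -/

/-- For `w ≡ 1` on `[0, 1]` (`H = L = id`) the abscissas (2.6.1.2) are the midpoints `x_i = (2i+1)/(2N)`.
[cite: DavisRabinowitz1984, Sect. 2.6.1 (2.6.1.2)] -/
theorem genMidpointNode_id {N : ℕ} (hN : N ≠ 0) (i : ℕ) :
    genMidpointNode id N i = (2 * i + 1) / (2 * N) := by
  have hN' : (N : ℝ) ≠ 0 := Nat.cast_ne_zero.mpr hN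
  unfold genMidpointNode
  simp only [id, integral_id]
  field_simp
  ring

/-- For `w ≡ 1` on `[0, 1]` (`L = id`) the generalized midpoint rule is the compound midpoint rule `M_N` on
`[0, 1]` ((2.1.3); `midpointRule` of `MidpointTrapezoidPeanoKernel`).
[cite: DavisRabinowitz1984, Sect. 2.6.1 (2.6.1.3)] [cite: DavisRabinowitz1984, Sect. 2.1 (2.1.3)] -/
theorem genMidpointRule_id_eq_midpointRule (f : ℝ → ℝ) {N : ℕ} (hN : N ≠ 0) :
    genMidpointRule f id N = midpointRule f N 0 1 := by
  have hN' : (N : ℝ) ≠ 0 := Nat.cast_ne_zero.mpr hN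
  rw [genMidpointRule, midpointRule, Finset.mul_sum]
  refine Finset.sum_congr rfl fun i _ => ?_
  rw [genMidpointNode_id hN]
  congr 1
  · rw [sub_zero, one_div]
  · congr 1
    field_simp
    ring

/-- [folklore] `Σ_{i<n} (2i+1)² = n(4n² - 1)/3`. -/
private theorem sum_range_sq_odd (n : ℕ) :
    ∑ i ∈ Finset.range n, (2 * (i : ℝ) + 1) ^ 2 = n * (4 * (n : ℝ) ^ 2 - 1) / 3 := by
  induction n with
  | zero => simp
  | succ n ih =>
    rw [Finset.sum_range_succ, ih]
    push_cast
    ring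

/-- For `w ≡ 1` on `[0, 1]` (`L = id`): `C_N = 1/3 - N⁻¹ Σ ((2i+1)/(2N))² = 1/(12N²)`, so that (2.6.1.4) reads
`E = f''/(24N²)`, the error of the compound midpoint rule (cf. (2.1.3), (2.6.5)).
[cite: DavisRabinowitz1984, Sect. 2.6.1 (2.6.1.4)] -/
theorem genMidpointErrConst_id {N : ℕ} (hN : N ≠ 0) : genMidpointErrConst id N = 1 / (12 * (N : ℝ) ^ 2) := by
  have hN' : (N : ℝ) ≠ 0 := Nat.cast_ne_zero.mpr hN
  unfold genMidpointErrConst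
  simp only [genMidpointNode_id hN, id, integral_pow]
  have hs : ∑ i ∈ Finset.range N, ((2 * (i : ℝ) + 1) / (2 * N)) ^ 2 =
      (∑ i ∈ Finset.range N, (2 * (i : ℝ) + 1) ^ 2) / (2 * (N : ℝ)) ^ 2 := by
    rw [Finset.sum_div]
    exact Finset.sum_congr rfl fun i _ => by rw [div_pow]
  rw [hs, sum_range_sq_odd]
  push_cast
  field_simp
  ring

end

end Literature.Analysis.Quadrature
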